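import Summits.RiemannHypothesis.RiemannHypothesis.Theorems.JensenLogBandArcWindowDeriv
import Summits.RiemannHypothesis.RiemannHypothesis.Theorems.JensenLogBandArcDescentR2Kernel
import HarnessLib

/-!
# Saddle displacement under a small change of centre ([DISP], near zone of the BAND crux)

RH ladder column JENSEN, rung J-P(P3) «log band», BAND crux `XiDerivBandRealAllRates`
(stmt-RiemannHypothesis-19913) of route «JensenLogBand», line «band-one-window» (top-shell reshape,
BAND lead rh-jensen-prover g8; the lead's ASK [DISP] of STATUS 05:38:24Z). RH-FREE `Γ`-factor
calculus. WHAT THIS IS NOT: nothing here bears on zeros of `ζ` or the truth of RH.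

Two centres `c₀ = x₀ + iT₀`, `c = x + iT` in regime R2 with `‖c − c₀‖ ≤ R ≤ 1/20` and band radii
`h₀ = h(n,T₀)`, `h = h(n,T)` with `|h − h₀| ≤ h/20`; saddles `u₀` (`S_{n,c₀}(u₀) = 0`) and `u*`
(`S_{n,c}(u*) = 0`) in their S3 discs. With the RIGID TRANSLATE `ũ = u₀ − c₀ + c`:

* `norm_lamPrime_sub_le` — `‖λ′(s₁) − λ′(s₀)‖ ≤ (9/T₀)‖s₁ − s₀‖` on the ball `‖s − (½+u₀)‖ ≤ R`;
* `norm_saddleDen_translate_sub_le` — `‖D_c(ũ) − D_{c₀}(u₀)‖ ≤ 11R/T₀`;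
* **`norm_arcSaddle_sub_translate_le`** ([DISP]): `‖u* − ũ‖ ≤ 110·n·R/(T₀·ℓ_T·ℓ_{T₀})`
  (`u* − c = n/D_c(u*)`, `ũ − c = n/D_{c₀}(u₀)`, `n/D_c` is `½`-Lipschitz on the disc, and
  `‖n/D_c(ũ) − n/D_{c₀}(u₀)‖ ≤ n‖ΔD‖/((9/20)²ℓℓ₀)`); with `n + 1 ≤ T₀/6`: `≤ R/20`.

(prover-rh-jensen-eng-2-g6-0, 2026-08-27.)
-/

noncomputable section

-- single-problem summit: `Summit.RiemannHypothesis.RiemannHypothesis.…` is the tree convention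
set_option linter.dupNamespace false

open Complex Real Set Metric

namespace Summit.RiemannHypothesis.RiemannHypothesis.Theorems.JensenPolynomials.LogBandArc

open Literature.NumberTheory.LFunctions

/-- **`λ′` is `9/T₀`-Lipschitz near a disc point:** for `s₀` with `Re s₀ ≥ 1/5`, `Im s₀ ≥ (79/100)T₀`
(`T₀ ≥ 100`) and `s₁` with `‖s₁ − s₀‖ ≤ R ≤ 1/20`: `‖λ′(s₁) − λ′(s₀)‖ ≤ (9/T₀)·‖s₁ − s₀‖`
(`‖λ″‖ ≤ 1/(2‖s‖) + 6/Im s` on the ball). RH-FREE. [folklore] -/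
theorem norm_lamPrime_sub_le {s₀ s₁ : ℂ} {T₀ R : ℝ} (hT₀ : 100 ≤ T₀) (hre : 1 / 5 ≤ s₀.re)
    (him : 79 / 100 * T₀ ≤ s₀.im) (hR : R ≤ 1 / 20) (hs : ‖s₁ - s₀‖ ≤ R) :
    ‖lamPrime s₁ - lamPrime s₀‖ ≤ 9 / T₀ * ‖s₁ - s₀‖ := by
  have hT0 : 0 < T₀ := by linarith
  set K : Set ℂ := closedBall s₀ R with hK
  have hmem : ∀ {z : ℂ}, z ∈ K → 1 / 10 ≤ z.re ∧ 78 / 100 * T₀ ≤ z.im := by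
    intro z hz
    rw [hK, mem_closedBall, dist_eq_norm] at hz
    have h1 : |(z - s₀).re| ≤ R := (Complex.abs_re_le_norm _).trans hz
    have h2 : |(z - s₀).im| ≤ R := (Complex.abs_im_le_norm _).trans hz
    rw [Complex.sub_re] at h1; rw [Complex.sub_im] at h2
    have h1' := abs_le.1 h1; have h2' := abs_le.1 h2
    constructor <;> linarith
  set L : ℂ → ℂ := fun z => -1 / z ^ 2 - 1 / (z - 1) ^ 2 + deriv Complex.digamma (z / 2) / 4 with hL
  have hderiv : ∀ z ∈ K, HasDerivWithinAt lamPrime (L z) K z := by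
    intro z hz
    obtain ⟨-, hzim⟩ := hmem hz
    have him0 : 0 < z.im := by linarith
    have h := hasDerivAt_xiGammaLogDeriv him0
    have e : lamPrime = fun w : ℂ => 1 / w + 1 / (w - 1) - Complex.log (Real.pi : ℂ) / 2 +
        Complex.digamma (w / 2) / 2 := by funext w; rfl
    rw [e]; exact h.hasDerivWithinAt
  have hbound : ∀ z ∈ K, ‖L z‖ ≤ 9 / T₀ := by
    intro z hz
    obtain ⟨hzre, hzim⟩ := hmem hz
    have hE := norm_xiGammaLogDeriv2_sub_le_of_re_nonneg (s := z) (by linarith) (by linarith)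
    have hzn : 78 / 100 * T₀ ≤ ‖z‖ := by
      have := Complex.abs_im_le_norm z
      rw [abs_of_pos (by linarith)] at this; linarith
    have h1 : ‖(1 : ℂ) / (2 * z)‖ ≤ 1 / (2 * (78 / 100 * T₀)) := by
      rw [norm_div, norm_one, norm_mul, Complex.norm_ofNat]
      exact one_div_le_one_div_of_le (by positivity) (by linarith)
    have h2 : 6 / z.im ≤ 6 / (78 / 100 * T₀) := div_le_div_of_nonneg_left (by norm_num) (by positivity) hzim
    calc ‖L z‖ = ‖(L z - 1 / (2 * z)) + 1 / (2 * z)‖ := by ring_nf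
      _ ≤ ‖L z - 1 / (2 * z)‖ + ‖(1 : ℂ) / (2 * z)‖ := norm_add_le _ _
      _ ≤ 6 / z.im + 1 / (2 * (78 / 100 * T₀)) := add_le_add hE h1
      _ ≤ 6 / (78 / 100 * T₀) + 1 / (2 * (78 / 100 * T₀)) := by linarith
      _ ≤ 9 / T₀ := by
          rw [div_add_div _ _ (by positivity) (by positivity), div_le_div_iff₀ (by positivity) hT0]
          nlinarith
  have hconv : Convex ℝ K := convex_closedBall _ _
  have hx : s₀ ∈ K := mem_closedBall_self (by linarith [norm_nonneg (s₁ - s₀)])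
  have hy : s₁ ∈ K := by rw [hK, mem_closedBall, dist_eq_norm]; exact hs
  exact hconv.norm_image_sub_le_of_norm_hasDerivWithin_le hderiv hbound hx hy

variable {n : ℕ} {x₀ T₀ x T R : ℝ} {u₀ u : ℂ}

set_option maxHeartbeats 400000 in -- long chain of explicit norm estimates in a large context, no search
/-- **The denominators at the translate:** with `ũ = u₀ − c₀ + c`,
`‖D_c(ũ) − D_{c₀}(u₀)‖ ≤ 11R/T₀` (λ′-Lipschitz `9R/T₀`, `‖1/ũ − 1/u₀‖ ≤ R/(0.7T₀)²`,
`(n+1)‖1/(ũ+c) − 1/(u₀+c₀)‖ ≤ 2(n+1)R/(1.7T₀)²` with `n+1 ≤ T₀/6`). RH-FREE. [folklore] -/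
theorem norm_saddleDen_translate_sub_le (hx₀ : |x₀| ≤ 1 / 2) (hT₀ : 100 ≤ T₀)
    (hℓ₀ : 20 ≤ ell T₀) (hh₀ : 1 / 2 ≤ bandRadius n T₀)
    (hh₀T : bandRadius n T₀ ≤ 7 / 20 * T₀) (hH₀ : bandRadius n T₀ ≤ 20)
    (hu₀ : ‖u₀ - ((x₀ : ℂ) + (T₀ : ℂ) * I + bandRadius n T₀)‖ ≤ 3 / 5 * bandRadius n T₀)
    (hR : R ≤ 1 / 20) (hcc : ‖((x : ℂ) + (T : ℂ) * I) - ((x₀ : ℂ) + (T₀ : ℂ) * I)‖ ≤ R) :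
    ‖saddleDen n ((x : ℂ) + (T : ℂ) * I) (u₀ - ((x₀ : ℂ) + (T₀ : ℂ) * I) + ((x : ℂ) + (T : ℂ) * I)) -
        saddleDen n ((x₀ : ℂ) + (T₀ : ℂ) * I) u₀‖ ≤ 11 * R / T₀ := by
  obtain ⟨-, -, -, hT1200, hnT⟩ := R2_bookkeeping hT₀ hℓ₀ hh₀ hH₀
  obtain ⟨him_lo, -, hre_lo, -, -, -, hnu_lo, hucim, -, hnuc⟩ :=
    disc_geometry hx₀ hT₀ hh₀ hh₀T hu₀
  have hT0 : 0 < T₀ := by linarith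
  have hR0 : 0 ≤ R := (norm_nonneg _).trans hcc
  generalize hc₀ : ((x₀ : ℂ) + (T₀ : ℂ) * I) = c₀ at *
  generalize hc : ((x : ℂ) + (T : ℂ) * I) = c at *
  set Δ : ℂ := c - c₀ with hΔ
  have hΔn : ‖Δ‖ ≤ R := hcc
  have eu : u₀ - c₀ + c = u₀ + Δ := by rw [hΔ]; ring
  rw [eu]
  -- (a) λ′
  have ha : ‖lamPrime (1 / 2 + (u₀ + Δ)) - lamPrime (1 / 2 + u₀)‖ ≤ 9 / T₀ * R := by
    have h1 := norm_lamPrime_sub_le (s₀ := 1 / 2 + u₀) (s₁ := 1 / 2 + (u₀ + Δ)) (T₀ := T₀) (R := R)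
      hT₀ (by linarith) him_lo hR (by rw [show 1 / 2 + (u₀ + Δ) - (1 / 2 + u₀) = Δ by ring]; exact hΔn)
    rw [show 1 / 2 + (u₀ + Δ) - (1 / 2 + u₀) = Δ by ring] at h1
    exact h1.trans (mul_le_mul_of_nonneg_left hΔn (by positivity))
  -- (b) `1/ũ − 1/u₀`
  have hnu : 79 / 100 * T₀ ≤ ‖u₀‖ := hnu_lo
  have hnut : 78 / 100 * T₀ ≤ ‖u₀ + Δ‖ := by
    have := norm_sub_norm_le u₀ (-Δ)
    rw [sub_neg_eq_add, norm_neg] at this; linarith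
  have hu0 : u₀ ≠ 0 := by intro h; rw [h, norm_zero] at hnu; linarith
  have hut0 : u₀ + Δ ≠ 0 := by intro h; rw [h, norm_zero] at hnut; linarith
  have hb : ‖1 / (u₀ + Δ) - 1 / u₀‖ ≤ R / T₀ := by
    have e : 1 / (u₀ + Δ) - 1 / u₀ = -Δ / ((u₀ + Δ) * u₀) := by field_simp; ring
    rw [e, norm_div, norm_neg, norm_mul]
    rw [div_le_div_iff₀ (by positivity) hT0]
    have : T₀ ≤ ‖u₀ + Δ‖ * ‖u₀‖ := by nlinarith
    nlinarith [norm_nonneg Δ]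
  -- (c) `(n+1)(1/(ũ+c) − 1/(u₀+c₀))`, `ũ + c − (u₀ + c₀) = 2Δ`
  have hupc : 179 / 100 * T₀ ≤ ‖u₀ + c₀‖ := hnuc
  have hupct : 178 / 100 * T₀ ≤ ‖u₀ + Δ + c‖ := by
    have e : u₀ + Δ + c = (u₀ + c₀) + 2 * Δ := by rw [hΔ]; ring
    rw [e]
    have := norm_sub_norm_le (u₀ + c₀) (-(2 * Δ))
    rw [sub_neg_eq_add, norm_neg, norm_mul, Complex.norm_ofNat] at this; linarith
  have hupc0 : u₀ + c₀ ≠ 0 := by intro h; rw [h, norm_zero] at hupc; linarith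
  have hupct0 : u₀ + Δ + c ≠ 0 := by intro h; rw [h, norm_zero] at hupct; linarith
  have hc' : ‖((n : ℂ) + 1) / (u₀ + Δ + c) - ((n : ℂ) + 1) / (u₀ + c₀)‖ ≤ R / T₀ := by
    have e2 : u₀ + Δ + c = u₀ + c₀ + 2 * Δ := by rw [hΔ]; ring
    have hne : u₀ + c₀ + 2 * Δ ≠ 0 := by rw [← e2]; exact hupct0
    have e : ((n : ℂ) + 1) / (u₀ + Δ + c) - ((n : ℂ) + 1) / (u₀ + c₀) =
        -(((n : ℂ) + 1) * (2 * Δ)) / ((u₀ + Δ + c) * (u₀ + c₀)) := by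
      rw [e2, div_sub_div _ _ hne hupc0]; ring
    rw [e, norm_div, norm_neg, norm_mul, norm_mul, norm_mul, Complex.norm_ofNat,
      show ((n : ℂ) + 1) = (((n : ℝ) + 1 : ℝ) : ℂ) by push_cast; ring, Complex.norm_real,
      Real.norm_eq_abs, abs_of_pos (by positivity)]
    rw [div_le_div_iff₀ (by positivity) hT0]
    have h3 : 3 * T₀ ^ 2 ≤ ‖u₀ + Δ + c‖ * ‖u₀ + c₀‖ := by nlinarith
    have h4 : ((n : ℝ) + 1) * ‖Δ‖ ≤ T₀ / 6 * R := mul_le_mul hnT hΔn (norm_nonneg _) (by positivity)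
    have h5 : R * (3 * T₀ ^ 2) ≤ R * (‖u₀ + Δ + c‖ * ‖u₀ + c₀‖) := mul_le_mul_of_nonneg_left h3 hR0
    have e3 : ((n : ℝ) + 1) * (2 * ‖Δ‖) * T₀ = 2 * T₀ * (((n : ℝ) + 1) * ‖Δ‖) := by ring
    have h6 : 2 * T₀ * (((n : ℝ) + 1) * ‖Δ‖) ≤ 2 * T₀ * (T₀ / 6 * R) :=
      mul_le_mul_of_nonneg_left h4 (by positivity)
    nlinarith [h5, h6, e3, hR0, hT0]
  -- assemble
  have hsplit : saddleDen n c (u₀ + Δ) - saddleDen n c₀ u₀ =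
      (lamPrime (1 / 2 + (u₀ + Δ)) - lamPrime (1 / 2 + u₀)) + (1 / (u₀ + Δ) - 1 / u₀) -
        (((n : ℂ) + 1) / (u₀ + Δ + c) - ((n : ℂ) + 1) / (u₀ + c₀)) := by
    rw [saddleDen, saddleDen]; ring
  rw [hsplit]
  calc ‖(lamPrime (1 / 2 + (u₀ + Δ)) - lamPrime (1 / 2 + u₀)) + (1 / (u₀ + Δ) - 1 / u₀) -
        (((n : ℂ) + 1) / (u₀ + Δ + c) - ((n : ℂ) + 1) / (u₀ + c₀))‖
      ≤ ‖lamPrime (1 / 2 + (u₀ + Δ)) - lamPrime (1 / 2 + u₀)‖ + ‖1 / (u₀ + Δ) - 1 / u₀‖ +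
        ‖((n : ℂ) + 1) / (u₀ + Δ + c) - ((n : ℂ) + 1) / (u₀ + c₀)‖ := by
        have h1 := norm_sub_le ((lamPrime (1 / 2 + (u₀ + Δ)) - lamPrime (1 / 2 + u₀)) +
          (1 / (u₀ + Δ) - 1 / u₀)) (((n : ℂ) + 1) / (u₀ + Δ + c) - ((n : ℂ) + 1) / (u₀ + c₀))
        have h2 := norm_add_le (lamPrime (1 / 2 + (u₀ + Δ)) - lamPrime (1 / 2 + u₀))
          (1 / (u₀ + Δ) - 1 / u₀)
        linarith
    _ ≤ 9 / T₀ * R + R / T₀ + R / T₀ := by linarith [ha, hb, hc']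
    _ = 11 * R / T₀ := by ring

set_option maxHeartbeats 400000 in -- long chain of explicit norm estimates in a large context, no search
/-- **[DISP] — saddle displacement.** Two centres in regime R2 with `‖c − c₀‖ ≤ R ≤ 1/20` and
`|h − h₀| ≤ h/20`; saddles `u₀`, `u*` in their S3 discs. Then with `ũ = u₀ − c₀ + c`:
`‖u* − ũ‖ ≤ 110·n·R/(T₀·ℓ_T·ℓ_{T₀})`. RH-FREE. [folklore] -/
theorem norm_arcSaddle_sub_translate_le (hx₀ : |x₀| ≤ 1 / 2) (hT₀ : 100 ≤ T₀)
    (hℓ₀ : 20 ≤ ell T₀) (hn : 100 ≤ n) (hh₀ : 1 / 2 ≤ bandRadius n T₀)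
    (hh₀T : bandRadius n T₀ ≤ 7 / 20 * T₀) (hH₀ : bandRadius n T₀ ≤ 20)
    (hu₀ : ‖u₀ - ((x₀ : ℂ) + (T₀ : ℂ) * I + bandRadius n T₀)‖ ≤ 3 / 5 * bandRadius n T₀)
    (hS₀ : arcSaddleFn n ((x₀ : ℂ) + (T₀ : ℂ) * I) u₀ = 0)
    (hx : |x| ≤ 1 / 2) (hT : 100 ≤ T) (hℓ : 20 ≤ ell T) (hh : 1 / 2 ≤ bandRadius n T)
    (hhT : bandRadius n T ≤ 7 / 20 * T)
    (hu : ‖u - ((x : ℂ) + (T : ℂ) * I + bandRadius n T)‖ ≤ 3 / 5 * bandRadius n T)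
    (hS : arcSaddleFn n ((x : ℂ) + (T : ℂ) * I) u = 0)
    (hR : R ≤ 1 / 20) (hcc : ‖((x : ℂ) + (T : ℂ) * I) - ((x₀ : ℂ) + (T₀ : ℂ) * I)‖ ≤ R)
    (hhh : |bandRadius n T - bandRadius n T₀| ≤ bandRadius n T / 20) :
    ‖u - (u₀ - ((x₀ : ℂ) + (T₀ : ℂ) * I) + ((x : ℂ) + (T : ℂ) * I))‖ ≤
      110 * n * R / (T₀ * ell T * ell T₀) := by
  have hR0 : 0 ≤ R := (norm_nonneg _).trans hcc
  have hT0 : 0 < T₀ := by linarith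
  have hℓ0 : 0 < ell T := by linarith
  have hℓ00 : 0 < ell T₀ := by linarith
  -- the translate lies in the disc about `c + h`
  have hhalf := norm_arcSaddle_sub_center_le_half hx₀ hT₀ hℓ₀ hn hh₀ hh₀T hu₀ hS₀
  have hut : ‖(u₀ - ((x₀ : ℂ) + (T₀ : ℂ) * I) + ((x : ℂ) + (T : ℂ) * I)) -
      ((x : ℂ) + (T : ℂ) * I + bandRadius n T)‖ ≤ 3 / 5 * bandRadius n T := by
    have e : (u₀ - ((x₀ : ℂ) + (T₀ : ℂ) * I) + ((x : ℂ) + (T : ℂ) * I)) -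
        ((x : ℂ) + (T : ℂ) * I + bandRadius n T) =
        (u₀ - ((x₀ : ℂ) + (T₀ : ℂ) * I + bandRadius n T₀)) +
          (((bandRadius n T₀ - bandRadius n T : ℝ)) : ℂ) := by push_cast; ring
    rw [e]
    refine (norm_add_le _ _).trans ?_
    rw [Complex.norm_real, Real.norm_eq_abs, abs_sub_comm]
    have := abs_le.1 hhh
    linarith [hhalf]
  -- the denominators
  have hΔD := norm_saddleDen_translate_sub_le hx₀ hT₀ hℓ₀ hh₀ hh₀T hH₀ hu₀ hR hcc
  obtain ⟨hR0_lo, -, -, -⟩ := saddleDen_re_im_bounds hx₀ hT₀ hℓ₀ hh₀ hh₀T hu₀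
  obtain ⟨hR_lo, -, -, -⟩ := saddleDen_re_im_bounds hx hT hℓ hh hhT hut
  -- `u* − c = n/D_c(u*)`, `u₀ − c₀ = n/D_{c₀}(u₀)`
  have hfix := sub_eq_div_saddleDen_of_arcSaddleFn_eq_zero hx hT hℓ hn hh hhT hu hS
  have hfix₀ := sub_eq_div_saddleDen_of_arcSaddleFn_eq_zero hx₀ hT₀ hℓ₀ hn hh₀ hh₀T hu₀ hS₀
  -- `½`-Lipschitz of `n/D_c` on the disc
  set K : Set ℂ := closedBall (((x : ℂ) + (T : ℂ) * I) + bandRadius n T) (3 / 5 * bandRadius n T) with hK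
  have hmemK : ∀ {w : ℂ}, w ∈ K ↔ ‖w - (((x : ℂ) + (T : ℂ) * I) + bandRadius n T)‖ ≤ 3 / 5 * bandRadius n T := by
    intro w; rw [hK, mem_closedBall, dist_eq_norm]
  set N : ℂ → ℂ := fun w => (n : ℂ) / saddleDen n ((x : ℂ) + (T : ℂ) * I) w with hN
  have hderiv : ∀ w ∈ K, HasDerivWithinAt N (deriv N w) K w := by
    intro w hw
    obtain ⟨N', hN', -⟩ := hasDerivAt_div_saddleDen hx hT hℓ hn hh hhT (hmemK.1 hw)
    exact (hN'.differentiableAt.hasDerivAt).hasDerivWithinAt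
  have hbound : ∀ w ∈ K, ‖deriv N w‖ ≤ 1 / 2 := by
    intro w hw
    obtain ⟨N', hN', hb⟩ := hasDerivAt_div_saddleDen hx hT hℓ hn hh hhT (hmemK.1 hw)
    rw [hN'.deriv]; exact hb
  have hLip := (convex_closedBall _ _).norm_image_sub_le_of_norm_hasDerivWithin_le hderiv hbound
    (hmemK.2 hut) (hmemK.2 hu)
  -- `N(u*) = u* − c`, `N(ũ)` vs `n/D_{c₀}(u₀) = u₀ − c₀ = ũ − c`
  generalize hc₀ : ((x₀ : ℂ) + (T₀ : ℂ) * I) = c₀ at *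
  generalize hc : ((x : ℂ) + (T : ℂ) * I) = c at *
  set ut : ℂ := u₀ - c₀ + c with hut_def
  have hNu : N u = u - c := by rw [hN]; exact hfix.symm
  have hD0 : saddleDen n c₀ u₀ ≠ 0 := by
    intro h0; rw [h0] at hR0_lo; simp at hR0_lo; linarith
  have hDt : saddleDen n c ut ≠ 0 := by
    intro h0; rw [h0] at hR_lo; simp at hR_lo; linarith
  have hkey : u - ut = (N u - N ut) + ((n : ℂ) / saddleDen n c ut - (n : ℂ) / saddleDen n c₀ u₀) := by
    rw [hNu, hN]; simp only; rw [← hfix₀, hut_def]; ring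
  -- the second difference: `n‖ΔD‖/(‖D_c(ũ)‖‖D_{c₀}(u₀)‖)`
  have hDn0 : 9 / 20 * ell T₀ ≤ ‖saddleDen n c₀ u₀‖ := by
    have := Complex.abs_re_le_norm (saddleDen n c₀ u₀)
    rw [abs_of_pos (by linarith)] at this; linarith
  have hDnt : 9 / 20 * ell T ≤ ‖saddleDen n c ut‖ := by
    have := Complex.abs_re_le_norm (saddleDen n c ut)
    rw [abs_of_pos (by linarith)] at this; linarith
  have hsecond : ‖(n : ℂ) / saddleDen n c ut - (n : ℂ) / saddleDen n c₀ u₀‖ ≤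
      55 * n * R / (T₀ * ell T * ell T₀) := by
    have e : (n : ℂ) / saddleDen n c ut - (n : ℂ) / saddleDen n c₀ u₀ =
        (n : ℂ) * (saddleDen n c₀ u₀ - saddleDen n c ut) / (saddleDen n c ut * saddleDen n c₀ u₀) := by
      rw [div_sub_div _ _ hDt hD0]; ring
    rw [e, norm_div, norm_mul, norm_mul, Complex.norm_natCast, norm_sub_rev]
    rw [div_le_div_iff₀ (by positivity) (by positivity)]
    have hprod : (9 / 20 * ell T) * (9 / 20 * ell T₀) ≤ ‖saddleDen n c ut‖ * ‖saddleDen n c₀ u₀‖ :=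
      mul_le_mul hDnt hDn0 (by positivity) (norm_nonneg _)
    have hn0 : (0 : ℝ) ≤ n := by positivity
    -- `n ‖ΔD‖ (T₀ ℓ ℓ₀) ≤ 55 n R (‖D‖‖D₀‖)`
    have hΔD' : ‖saddleDen n c ut - saddleDen n c₀ u₀‖ * T₀ ≤ 11 * R := (le_div_iff₀ hT0).1 hΔD
    have e1 : (n : ℝ) * ‖saddleDen n c ut - saddleDen n c₀ u₀‖ * (T₀ * ell T * ell T₀) =
        (n : ℝ) * (‖saddleDen n c ut - saddleDen n c₀ u₀‖ * T₀) * (ell T * ell T₀) := by ring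
    have s1 : (n : ℝ) * (‖saddleDen n c ut - saddleDen n c₀ u₀‖ * T₀) * (ell T * ell T₀) ≤
        (n : ℝ) * (11 * R) * (ell T * ell T₀) :=
      mul_le_mul_of_nonneg_right (mul_le_mul_of_nonneg_left hΔD' hn0) (by positivity)
    have s2 : ell T * ell T₀ ≤ 400 / 81 * (‖saddleDen n c ut‖ * ‖saddleDen n c₀ u₀‖) := by
      linarith only [hprod]
    have s3 : (n : ℝ) * (11 * R) * (ell T * ell T₀) ≤
        (n : ℝ) * (11 * R) * (400 / 81 * (‖saddleDen n c ut‖ * ‖saddleDen n c₀ u₀‖)) :=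
      mul_le_mul_of_nonneg_left s2 (by positivity)
    have s4 : 0 ≤ (n : ℝ) * R * (‖saddleDen n c ut‖ * ‖saddleDen n c₀ u₀‖) := by positivity
    rw [e1]
    linarith only [s1, s3, s4]
  -- conclude: `‖u − ũ‖ ≤ ½‖u − ũ‖ + second`
  have htri : ‖u - ut‖ ≤ 1 / 2 * ‖u - ut‖ + 55 * n * R / (T₀ * ell T * ell T₀) := by
    calc ‖u - ut‖ = ‖(N u - N ut) + ((n : ℂ) / saddleDen n c ut - (n : ℂ) / saddleDen n c₀ u₀)‖ := by
          rw [← hkey]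
      _ ≤ ‖N u - N ut‖ + ‖(n : ℂ) / saddleDen n c ut - (n : ℂ) / saddleDen n c₀ u₀‖ := norm_add_le _ _
      _ ≤ 1 / 2 * ‖u - ut‖ + 55 * n * R / (T₀ * ell T * ell T₀) := add_le_add hLip hsecond
  have : ‖u - ut‖ ≤ 2 * (55 * n * R / (T₀ * ell T * ell T₀)) := by linarith
  calc ‖u - ut‖ ≤ 2 * (55 * n * R / (T₀ * ell T * ell T₀)) := this
    _ = 110 * n * R / (T₀ * ell T * ell T₀) := by ring

end Summit.RiemannHypothesis.RiemannHypothesis.Theorems.JensenPolynomials.LogBandArc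

end
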